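import Literature.LinearAlgebra.Matrix.CrossInterpolation

/-!
# Tensor cross interpolation: the TCI form of a tensor train and its interpolation property

Let `F` be a tensor with `L = n+1` legs, each leg indexed by `σ`; we model it as a function
`F : List σ → K` on configurations (lists of leg indices; its values on lists of the wrong length
are never used).  A TENSOR CROSS INTERPOLATION (TCI) of `F` is determined by PIVOT LISTS
[NunezFernandezEtAl2025, §4.1]: for every bond `ℓ = 0, …, L` a list `I_ℓ` of `χ_ℓ` "row"
multi-indices `(σ₁, …, σ_ℓ)` and a list `J_{ℓ+1}` of `χ_ℓ` "column" multi-indices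
`(σ_{ℓ+1}, …, σ_L)`, with `I_0 = J_{L+1} = {()}`.  From them one forms the slices
`P_ℓ = F(I_ℓ, J_{ℓ+1})` (the `χ_ℓ × χ_ℓ` PIVOT MATRICES) and `T_ℓ = F(I_{ℓ-1}, 𝕊_ℓ, J_{ℓ+1})`
(the SITE TENSORS), and the TCI FORM
`F̃_σ = T₁^{σ₁} P₁⁻¹ T₂^{σ₂} P₂⁻¹ ⋯ P_{L-1}⁻¹ T_L^{σ_L}` [NunezFernandezEtAl2025, §4.1;
NunezFernandezEtAl2022, eq. (16)], a tensor train of bond dimensions `χ_ℓ` built entirely from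
entries of `F`.  The central algebraic fact behind all TCI algorithms is the INTERPOLATION
PROPERTY [NunezFernandezEtAl2025, §4.2 and App. A.3; NunezFernandezEtAl2022, eqs. (17)–(18) and
App. C.1]: if the pivot lists satisfy the NESTING CONDITIONS `I_0 < I_1 < ⋯ < I_{L-1}` (each row
pivot extends a row pivot of the previous bond by one leg index) and `J_2 > ⋯ > J_{L+1}`, and the
pivot matrices are nonsingular, then `F̃ = F` on every slice `T_ℓ` and `P_ℓ`, i.e. on every
entry of `F` used to build `F̃`.

This file formalises that statement for an arbitrary number of legs and arbitrary
(rank-adaptive) bond dimensions, over any commutative ring.  Legs are numbered from `0` here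
(`0, …, n`, so leg `k` is the paper's leg `k+1`) and bonds `0, …, n+1` as in the paper; in the
declaration docstrings `T_k` stands for the site tensor of leg `k` (`siteMat k`, the paper's
`T_{k+1}`), while `P_ℓ` (`pivMat ℓ`), `I_ℓ` (the row pivots `row ℓ`) and `J_{ℓ+1}` (the column
pivots `col ℓ`) keep the paper's bond numbering:

* `TCIPivots σ` — the pivot data: `n`, bond dimensions `χ : ℕ → ℕ` with `χ 0 = χ (n+1) = 1`,
  row pivots `row ℓ : Fin (χ ℓ) → List σ` of length `ℓ` (the list `I_ℓ`) and column pivots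
  `col ℓ : Fin (χ ℓ) → List σ` of length `n+1-ℓ` (the list `J_{ℓ+1}`)
  [NunezFernandezEtAl2025, §4.1];
* `pivMat p F ℓ` — `P_ℓ`, `(x, y) ↦ F (row ℓ x ++ col ℓ y)`; `siteMat p F k a` — the site
  tensor of leg `k` at leg value `a` (the paper's `T_{k+1}^{a}`),
  `(x, y) ↦ F (row k x ++ a :: col (k+1) y)`, a `χ_k × χ_{k+1}` matrix
  [NunezFernandezEtAl2025, §4.1];
* `tciForm p F s`, `tciEval p F s` — the TCI form
  `siteMat 0 (s 0) · (pivMat 1)⁻¹ · siteMat 1 (s 1) ⋯ (pivMat n)⁻¹ · siteMat n (s n)` at the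
  configuration `s : ℕ → σ` (a `1 × 1` matrix, resp. its entry), via the partial products
  `leftProd`, `rightProd`; `tciForm_eq_leftProd_mul_siteMat_mul_rightProd` splits the train at
  any leg [NunezFernandezEtAl2025, §4.1; NunezFernandezEtAl2022, eq. (16)];
* `tciEval_eq_sum_bond`, `leftProd_congr`, `rightProd_congr` — it is a TENSOR TRAIN of bond
  dimensions `χ_ℓ`: across every bond the value is a sum of `χ_ℓ` products of a factor
  depending only on the legs left of the bond and a factor depending only on the legs right of
  it [NunezFernandezEtAl2025, §4.1; GolubVanLoan2013, §12.5.8 (12.5.25)];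
* `RowNested p ℓ` (`I_ℓ < I_{ℓ+1}`), `ColNested p ℓ` (`J_{ℓ+1} > J_{ℓ+2}`), `FullyNested p` —
  the nesting conditions [NunezFernandezEtAl2025, §4.2; NunezFernandezEtAl2022, eq. (17)];
* `siteMat_mul_inv_pivMat_apply`, `inv_pivMat_mul_siteMat_apply` — the Kronecker identities
  `[T^σ P⁻¹]_{i i'} = δ_{i ⊕ (σ), i'}` for `i ⊕ (σ)` a row pivot and
  `[P⁻¹ T^σ]_{j' j} = δ_{j', (σ) ⊕ j}` for `(σ) ⊕ j` a column pivot [NunezFernandezEtAl2025,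
  App. A.3; NunezFernandezEtAl2022, App. C.1]; `leftProd_apply_of_rowNested`,
  `rightProd_apply_of_colNested` — the TELESCOPE COLLAPSES of `T P⁻¹ T P⁻¹ ⋯`
  (resp. `⋯ P⁻¹ T P⁻¹ T`) to a unit vector along a nested chain of pivots
  [NunezFernandezEtAl2025, App. A.3];
* `tciForm_apply_of_nested`, `tciEval_of_nested`, `tciEval_toSeq_slice` — 1-SITE NESTING: if
  the pivots are nested w.r.t. the site tensor of leg `k` (`I_0 < ⋯ < I_k`,
  `J_{k+2} > ⋯ > J_{n+2}`) then `F̃ = F` on the one-dimensional slice `I_k ⊕ 𝕊 ⊕ J_{k+2}`;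
  `tciEval_of_fullyNested` — a fully nested TCI form is exact on all these slices, i.e. it
  INTERPOLATES `F` [NunezFernandezEtAl2025, §4.2 and App. A.3; NunezFernandezEtAl2022,
  eq. (18), App. C.1];
* `tciForm_apply_of_nested_pivot`, `tciEval_toSeq_pivot` — 0-SITE NESTING: `F̃ = F` on the
  pivots, `F̃(I_ℓ, J_{ℓ+1}) = P_ℓ`; `rank_unfolding_eq` — consequently every finite
  sub-unfolding of `F̃` across bond `ℓ` containing the pivots has rank exactly `χ_ℓ`
  [NunezFernandezEtAl2025, App. A.3];
* `tciForm_eq_leftProd_mul_twoSite_mul_rightProd`, `tciForm_apply_of_nested_twoSite` — 2-SITE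
  NESTING: on the two-dimensional slice `I_k ⊕ 𝕊 ⊕ 𝕊 ⊕ J_{k+3}` the TCI form equals the
  two-site block `T P⁻¹ T'`, so the global error `F - F̃` there equals the error of the local
  matrix cross interpolation `Π ≈ T P⁻¹ T'` that the 2-site algorithm minimises
  [NunezFernandezEtAl2025, §4.3.1 and App. A.3].

Inverses are Mathlib's `Matrix.inv` (junk value `0` for a singular matrix); every interpolation
statement assumes `IsUnit (P_ℓ).det` for the inner bonds `1 ≤ ℓ ≤ n`, as the paper does
(`det P_ℓ ≠ 0`).  The matrix-level kernel (`C P⁻¹ R`, Schur complements, exactness at full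
rank) is `Literature.LinearAlgebra.Matrix.CrossInterpolation`, of which only the rank lemma
`card_le_rank_of_isUnit_det_submatrix` is used here.  Not formalised: anything algorithmic or
approximate — pivot search and update (2-site / 1-site / 0-site sweeps, rook and block-rook
search, global pivot insertion), error estimates and the environment weighting, the
CI-canonical form and the conversion of an arbitrary tensor train to TCI form, the
exact-recovery statement for tensors of TT-rank `χ`, and the continuum version
[NunezFernandezEtAl2025, §§4.3–4.7 and App. A.4].

References: Y. Núñez Fernández, M. K. Ritter, M. Jeannin, J.-W. Li, T. Kloss, T. Louvet,
S. Terasaki, O. Parcollet, J. von Delft, H. Shinaoka, X. Waintal, *Learning tensor networks with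
tensor cross interpolation: new algorithms and libraries*, SciPost Phys. 18 (2025) 104,
arXiv:2407.02454 (`NunezFernandezEtAl2025`), §4.1, §4.2, §4.3.1, App. A.3; Y. Núñez Fernández,
M. Jeannin, P. T. Dumitrescu, T. Kloss, J. Kaye, O. Parcollet, X. Waintal, *Learning Feynman
diagrams with tensor trains*, Phys. Rev. X 12 (2022) 041018, arXiv:2207.06135
(`NunezFernandezEtAl2022`), §III.B, eqs. (16)–(18), App. C.1; G. H. Golub, C. F. Van Loan,
*Matrix Computations*, 4th ed., Johns Hopkins University Press 2013 (`GolubVanLoan2013`),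
§12.5.8 (the tensor-train format).  Both papers attribute the interpolation property of nested
cross approximations to I. Oseledets, E. Tyrtyshnikov, *TT-cross approximation for
multidimensional arrays*, Linear Algebra Appl. 432 (2010) 70–88.

AI-produced formalisation (H21 engines group, seat eng-quad-2, 2026-08-21); no facts, no axioms
beyond Mathlib's, no `sorry`.
-/

open Matrix

namespace Literature.LinearAlgebra.TensorNetworks

/-! ### Configurations: prefixes and windows of an index sequence -/

section Config

variable {σ : Type*}

/-- `pfx s k = [s 0, …, s (k-1)]`, the length-`k` prefix of the index sequence `s`
(the multi-index `(σ₁, …, σ_k)` of the first `k` legs).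
[cite: NunezFernandezEtAl2025, §4.1] -/
def pfx (s : ℕ → σ) : ℕ → List σ
  | 0 => []
  | k + 1 => pfx s k ++ [s k]

/-- `sfx s k m = [s k, …, s (k+m-1)]`, the window of `m` indices starting at leg `k`.
[cite: NunezFernandezEtAl2025, §4.1] -/
def sfx (s : ℕ → σ) : ℕ → ℕ → List σ
  | _, 0 => []
  | k, m + 1 => s k :: sfx s (k + 1) m

/-- [folklore] -/
@[simp] private theorem pfx_zero (s : ℕ → σ) : pfx s 0 = [] := rfl

/-- [folklore] -/
private theorem pfx_succ (s : ℕ → σ) (k : ℕ) : pfx s (k + 1) = pfx s k ++ [s k] := rfl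

/-- [folklore] -/
@[simp] private theorem sfx_zero (s : ℕ → σ) (k : ℕ) : sfx s k 0 = [] := rfl

/-- [folklore] -/
private theorem sfx_succ (s : ℕ → σ) (k m : ℕ) : sfx s k (m + 1) = s k :: sfx s (k + 1) m := rfl

/-- [folklore] -/
@[simp] private theorem length_pfx (s : ℕ → σ) (k : ℕ) : (pfx s k).length = k := by
  induction k with
  | zero => rfl
  | succ k ih => simp [pfx_succ, ih]

/-- [folklore] -/
@[simp] private theorem length_sfx (s : ℕ → σ) (k m : ℕ) : (sfx s k m).length = m := by
  induction m generalizing k with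
  | zero => rfl
  | succ m ih => simp [sfx_succ, ih]

/-- [folklore] -/
private theorem sfx_succ' (s : ℕ → σ) (k m : ℕ) : sfx s k (m + 1) = sfx s k m ++ [s (k + m)] := by
  induction m generalizing k with
  | zero => simp [sfx_succ]
  | succ m ih =>
      rw [sfx_succ, ih (k + 1), sfx_succ, List.cons_append]
      have : k + 1 + m = k + (m + 1) := by omega
      rw [this]

/-- [folklore] -/
private theorem pfx_add (s : ℕ → σ) (k m : ℕ) : pfx s (k + m) = pfx s k ++ sfx s k m := by
  induction m with
  | zero => simp
  | succ m ih => rw [← Nat.add_assoc, pfx_succ, ih, sfx_succ', List.append_assoc]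

/-- Splitting a full configuration at leg `k`: `(σ₁…σ_L) = (σ₁…σ_{k}) ⊕ σ_{k+1} ⊕ (σ_{k+2}…σ_L)`.
[folklore] -/
private theorem pfx_eq_pfx_append_cons_sfx (s : ℕ → σ) {k n : ℕ} (hk : k ≤ n) :
    pfx s (n + 1) = pfx s k ++ s k :: sfx s (k + 1) (n - k) := by
  have : n + 1 = k + (n - k + 1) := by omega
  rw [this, pfx_add, sfx_succ]

/-- The index sequence read off a finite configuration `l` (padded with `d` beyond its length).
[folklore] -/
def toSeq (l : List σ) (d : σ) : ℕ → σ := fun t => l.getD t d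

/-- [folklore] -/
private theorem pfx_toSeq (l : List σ) (d : σ) : ∀ k, k ≤ l.length → pfx (toSeq l d) k = l.take k
  | 0, _ => by simp
  | k + 1, hk => by
      rw [pfx_succ, pfx_toSeq l d k (Nat.le_of_succ_le hk), List.take_succ_eq_append_getElem hk]
      simp only [toSeq, List.getD_eq_getElem l d hk]

/-- [folklore] -/
private theorem sfx_toSeq (l : List σ) (d : σ) :
    ∀ m k, k + m ≤ l.length → sfx (toSeq l d) k m = (l.drop k).take m
  | 0, _, _ => by simp
  | m + 1, k, hk => by
      have hk' : k < l.length := by omega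
      rw [sfx_succ, sfx_toSeq l d m (k + 1) (by omega), List.drop_eq_getElem_cons hk',
        List.take_succ_cons]
      simp only [toSeq, List.getD_eq_getElem l d hk']

/-- [folklore] -/
private theorem pfx_toSeq_length (l : List σ) (d : σ) : pfx (toSeq l d) l.length = l := by
  rw [pfx_toSeq l d l.length le_rfl, List.take_length]

/-- [folklore] -/
private theorem pfx_toSeq_append (l₁ l₂ : List σ) (d : σ) :
    pfx (toSeq (l₁ ++ l₂) d) l₁.length = l₁ := by
  rw [pfx_toSeq _ d _ (by simp), List.take_left]

/-- [folklore] -/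
private theorem sfx_toSeq_append (l₁ l₂ : List σ) (d : σ) :
    sfx (toSeq (l₁ ++ l₂) d) l₁.length l₂.length = l₂ := by
  rw [sfx_toSeq _ d _ _ (by simp), List.drop_left, List.take_length]

/-- [folklore] -/
private theorem toSeq_append_of_lt (l₁ l₂ : List σ) (d : σ) {j : ℕ} (hj : j < l₁.length) :
    toSeq (l₁ ++ l₂) d j = toSeq l₁ d j :=
  List.getD_append l₁ l₂ d j hj

/-- [folklore] -/
private theorem toSeq_append_of_le (l₁ l₁' l₂ : List σ) (d : σ) (h : l₁.length = l₁'.length) {j : ℕ}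
    (hj : l₁.length ≤ j) : toSeq (l₁ ++ l₂) d j = toSeq (l₁' ++ l₂) d j := by
  simp only [toSeq]
  rw [List.getD_append_right _ _ _ _ hj, List.getD_append_right _ _ _ _ (h ▸ hj), h]

end Config

/-! ### Pivot lists and the matrices `P_ℓ` (`pivMat ℓ`) and `T_k` (`siteMat k`, leg `k` from `0`) -/

/-- The pivot data of a tensor cross interpolation of an `(n+1)`-leg tensor with legs indexed by
`σ` [cite: NunezFernandezEtAl2025, §4.1]: bonds `ℓ = 0, …, n+1` sit between the legs (`ℓ = 0`
before the first leg, `ℓ = n+1` after the last), bond `ℓ` carries `χ ℓ` ROW PIVOTS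
`row ℓ x ∈ I_ℓ` (multi-indices of the legs `< ℓ`, i.e. lists of length `ℓ`) and `χ ℓ` COLUMN
PIVOTS `col ℓ y ∈ J_{ℓ+1}` (multi-indices of the legs `≥ ℓ`, lists of length `n + 1 - ℓ`), in
equal number so that every pivot matrix is square; the outer bonds are trivial,
`χ 0 = χ (n+1) = 1` (`I_0 = J_{L+1} = {()}`).  The fields `χ ℓ`, `row ℓ`, `col ℓ` for `ℓ > n+1`
are junk and never used.  Rank-adaptive: the bond dimensions `χ ℓ` are arbitrary.  Distinctness
of the pivots is not part of the structure (a repeated pivot makes `P_ℓ` singular, and every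
interpolation statement assumes `IsUnit (P_ℓ).det`). -/
structure TCIPivots (σ : Type*) where
  /-- number of legs minus one: the legs are `0, …, n` -/
  n : ℕ
  /-- bond dimension (number of pivots) at bond `ℓ` -/
  χ : ℕ → ℕ
  /-- the row pivots `I_ℓ` (multi-indices of the legs `< ℓ`) -/
  row : (ℓ : ℕ) → Fin (χ ℓ) → List σ
  /-- the column pivots `J_{ℓ+1}` (multi-indices of the legs `≥ ℓ`) -/
  col : (ℓ : ℕ) → Fin (χ ℓ) → List σ
  χ_zero : χ 0 = 1
  χ_last : χ (n + 1) = 1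
  length_row : ∀ (ℓ : ℕ) (x : Fin (χ ℓ)), (row ℓ x).length = ℓ
  length_col : ∀ (ℓ : ℕ) (y : Fin (χ ℓ)), (col ℓ y).length = n + 1 - ℓ

namespace TCIPivots

variable {σ : Type*} (p : TCIPivots σ) {K : Type*} [CommRing K] (F : List σ → K)

/-- [folklore] -/
private theorem eq_of_bond_zero (x x' : Fin (p.χ 0)) : x = x' := by
  have h₁ := x.isLt; have h₂ := x'.isLt
  simp only [p.χ_zero] at h₁ h₂
  exact Fin.ext (by omega)

/-- [folklore] -/
private theorem eq_of_bond_last (y y' : Fin (p.χ (p.n + 1))) : y = y' := by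
  have h₁ := y.isLt; have h₂ := y'.isLt
  simp only [p.χ_last] at h₁ h₂
  exact Fin.ext (by omega)

/-- The unique row index of the trivial bond `0` (`I_0 = {()}`, `χ_0 = 1`).
[cite: NunezFernandezEtAl2025, §4.1] -/
def rowZero : Fin (p.χ 0) := ⟨0, by simp [p.χ_zero]⟩

/-- The unique column index of the trivial bond `n+1` (`J_{L+1} = {()}`, `χ_L = 1`).
[cite: NunezFernandezEtAl2025, §4.1] -/
def colLast : Fin (p.χ (p.n + 1)) := ⟨0, by simp [p.χ_last]⟩

/-- The PIVOT MATRIX `P_ℓ = F(I_ℓ, J_{ℓ+1})`, `(P_ℓ)_{x y} = F (row ℓ x ⊕ col ℓ y)`: the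
`χ_ℓ × χ_ℓ` slice of the tensor on the pivots of bond `ℓ` (a "0-dimensional slice").
[cite: NunezFernandezEtAl2025, §4.1] -/
def pivMat (ℓ : ℕ) : Matrix (Fin (p.χ ℓ)) (Fin (p.χ ℓ)) K :=
  Matrix.of fun x y => F (p.row ℓ x ++ p.col ℓ y)

/-- The SITE TENSOR of leg `ℓ` (legs numbered from `0`; the paper's `T_{ℓ+1}`) at fixed leg
value `a`, as a `χ_ℓ × χ_{ℓ+1}` matrix: `(x, y) ↦ F (row ℓ x ⊕ (a) ⊕ col (ℓ+1) y)` with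
`row ℓ x ∈ I_ℓ`, `col (ℓ+1) y ∈ J_{ℓ+2}` (a "1-dimensional slice" of `F`).
[cite: NunezFernandezEtAl2025, §4.1] -/
def siteMat (ℓ : ℕ) (a : σ) : Matrix (Fin (p.χ ℓ)) (Fin (p.χ (ℓ + 1))) K :=
  Matrix.of fun x y => F (p.row ℓ x ++ a :: p.col (ℓ + 1) y)

omit [CommRing K] in
/-- Entries of the pivot matrix: `(P_ℓ)_{x y} = F (row ℓ x ⊕ col ℓ y)`.
[cite: NunezFernandezEtAl2025, §4.1] -/
@[simp] theorem pivMat_apply (ℓ : ℕ) (x y : Fin (p.χ ℓ)) :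
    p.pivMat F ℓ x y = F (p.row ℓ x ++ p.col ℓ y) := rfl

omit [CommRing K] in
/-- Entries of the site tensor: `(T_ℓ^a)_{x y} = F (row ℓ x ⊕ (a) ⊕ col (ℓ+1) y)`.
[cite: NunezFernandezEtAl2025, §4.1] -/
@[simp] theorem siteMat_apply (ℓ : ℕ) (a : σ) (x : Fin (p.χ ℓ)) (y : Fin (p.χ (ℓ + 1))) :
    p.siteMat F ℓ a x y = F (p.row ℓ x ++ a :: p.col (ℓ + 1) y) := rfl

/-! ### The TCI form `F̃ = T₀ P₁⁻¹ T₁ P₂⁻¹ ⋯ P_n⁻¹ T_n` -/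

/-- Left partial product `T₀^{s 0} P₁⁻¹ T₁^{s 1} P₂⁻¹ ⋯ T_{k-1}^{s (k-1)} P_k⁻¹`
(a `χ_0 × χ_k` matrix; `= 1` for `k = 0`).  [cite: NunezFernandezEtAl2025, §4.1 and App. A.3] -/
noncomputable def leftProd (s : ℕ → σ) : (k : ℕ) → Matrix (Fin (p.χ 0)) (Fin (p.χ k)) K
  | 0 => 1
  | k + 1 => leftProd s k * (p.siteMat F k (s k) * (p.pivMat F (k + 1))⁻¹)

/-- The matrix `(x, y) ↦ [x = y]` between the index types of bonds `ℓ` and `n+1`; it is the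
identity matrix when `ℓ = n+1` and is only used there (it lets `rightProd` be defined without
dependent casts).  [folklore] -/
def bdry (ℓ : ℕ) : Matrix (Fin (p.χ ℓ)) (Fin (p.χ (p.n + 1))) K :=
  Matrix.of fun x y => if (x : ℕ) = (y : ℕ) then 1 else 0

/-- Right partial product `P_k⁻¹ T_k^{s k} P_{k+1}⁻¹ T_{k+1}^{s (k+1)} ⋯ P_n⁻¹ T_n^{s n}`
(a `χ_k × χ_{n+1}` matrix; the identity for `k = n+1`).
[cite: NunezFernandezEtAl2025, §4.1 and App. A.3] -/
noncomputable def rightProd (s : ℕ → σ) (k : ℕ) : Matrix (Fin (p.χ k)) (Fin (p.χ (p.n + 1))) K :=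
  if _ : k ≤ p.n then (p.pivMat F k)⁻¹ * p.siteMat F k (s k) * rightProd s (k + 1) else p.bdry k
termination_by p.n + 1 - k
decreasing_by omega

/-- The TCI FORM (tensor cross interpolation) built from the pivot lists,
`F̃(s) = T₀^{s 0} P₁⁻¹ T₁^{s 1} P₂⁻¹ ⋯ P_n⁻¹ T_n^{s n}`, as a `χ_0 × χ_{n+1} = 1 × 1` matrix
(its unique entry is `tciEval`).  `P_ℓ⁻¹` is Mathlib's `Matrix.inv` (junk value `0` when `P_ℓ` is
singular; every interpolation statement below assumes `IsUnit (P_ℓ).det` for `1 ≤ ℓ ≤ n`).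
[cite: NunezFernandezEtAl2025, §4.1; NunezFernandezEtAl2022, eq. (16)] -/
noncomputable def tciForm (s : ℕ → σ) : Matrix (Fin (p.χ 0)) (Fin (p.χ (p.n + 1))) K :=
  p.siteMat F 0 (s 0) * p.rightProd F s 1

/-- The value `F̃(s)` of the TCI form at the configuration `s` (the unique entry of the `1 × 1`
matrix `tciForm`).  [cite: NunezFernandezEtAl2025, §4.1; NunezFernandezEtAl2022, eq. (16)] -/
noncomputable def tciEval (s : ℕ → σ) : K := ∑ x, ∑ y, p.tciForm F s x y

/-- One step of the right partial product: for `k ≤ n`,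
`rightProd k = P_k⁻¹ T_k^{s k} · rightProd (k+1)`.  [cite: NunezFernandezEtAl2025, §4.1] -/
theorem rightProd_of_le (s : ℕ → σ) {k : ℕ} (hk : k ≤ p.n) :
    p.rightProd F s k = (p.pivMat F k)⁻¹ * p.siteMat F k (s k) * p.rightProd F s (k + 1) := by
  rw [rightProd, dif_pos hk]

/-- The right partial product past the last leg is the `1 × 1` identity (`J_{L+1} = {()}`).
[cite: NunezFernandezEtAl2025, §4.1] -/
theorem rightProd_last (s : ℕ → σ) : p.rightProd F s (p.n + 1) = 1 := by
  rw [rightProd, dif_neg (by omega)]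
  ext x y
  simp [bdry, Matrix.one_apply, Fin.ext_iff]

/-- One step of the left partial product: `leftProd (k+1) = leftProd k · T_k^{s k} P_{k+1}⁻¹`.
[cite: NunezFernandezEtAl2025, §4.1] -/
theorem leftProd_succ (s : ℕ → σ) (k : ℕ) :
    p.leftProd F s (k + 1) = p.leftProd F s k * (p.siteMat F k (s k) * (p.pivMat F (k + 1))⁻¹) :=
  rfl

/-- `F̃(s)` is the unique entry of the `1 × 1` matrix `tciForm s` (`χ 0 = χ (n+1) = 1`,
`I_0 = J_{L+1} = {()}`).  [cite: NunezFernandezEtAl2025, §4.1] -/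
theorem tciEval_eq_tciForm (s : ℕ → σ) (x₀ : Fin (p.χ 0)) (y₀ : Fin (p.χ (p.n + 1))) :
    p.tciEval F s = p.tciForm F s x₀ y₀ := by
  unfold tciEval
  rw [Fintype.sum_eq_single x₀ fun x hx => absurd (p.eq_of_bond_zero x x₀) hx,
    Fintype.sum_eq_single y₀ fun y hy => absurd (p.eq_of_bond_last y y₀) hy]

/-- SPLITTING the train at leg `k`: `F̃(s) = (T₀ P₁⁻¹ ⋯ T_{k-1} P_k⁻¹) · T_k^{s k} ·
(P_{k+1}⁻¹ T_{k+1} ⋯ P_n⁻¹ T_n)`.  [cite: NunezFernandezEtAl2025, App. A.3] -/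
theorem tciForm_eq_leftProd_mul_siteMat_mul_rightProd (s : ℕ → σ) :
    ∀ k, k ≤ p.n →
      p.tciForm F s = p.leftProd F s k * p.siteMat F k (s k) * p.rightProd F s (k + 1)
  | 0, _ => by simp [tciForm, leftProd]
  | k + 1, hk => by
      rw [tciForm_eq_leftProd_mul_siteMat_mul_rightProd s k (Nat.le_of_succ_le hk), leftProd_succ,
        p.rightProd_of_le F s hk]
      simp only [Matrix.mul_assoc]

/-! ### Tensor-train structure -/

/-- The left partial product `T₀^{s 0} P₁⁻¹ ⋯ T_{k-1}^{s (k-1)} P_k⁻¹` depends only on the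
indices `s 0, …, s (k-1)` of the legs left of bond `k` (tensor-train structure).
[cite: NunezFernandezEtAl2025, §4.1] -/
theorem leftProd_congr {s s' : ℕ → σ} : ∀ k, (∀ j < k, s j = s' j) →
    p.leftProd F s k = p.leftProd F s' k
  | 0, _ => rfl
  | k + 1, h => by
      rw [leftProd_succ, leftProd_succ, leftProd_congr k fun j hj => h j (Nat.lt_succ_of_lt hj),
        h k (Nat.lt_succ_self k)]

/-- The right partial product `P_k⁻¹ T_k^{s k} ⋯ P_n⁻¹ T_n^{s n}` depends only on the indices
`s k, …, s n` of the legs right of bond `k` (tensor-train structure).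
[cite: NunezFernandezEtAl2025, §4.1] -/
theorem rightProd_congr {s s' : ℕ → σ} :
    ∀ m k, k + m = p.n + 1 → (∀ j, k ≤ j → s j = s' j) → p.rightProd F s k = p.rightProd F s' k
  | 0, k, hk, _ => by
      obtain rfl : k = p.n + 1 := by omega
      rw [rightProd_last, rightProd_last]
  | m + 1, k, hk, h => by
      have hkn : k ≤ p.n := by omega
      rw [p.rightProd_of_le F s hkn, p.rightProd_of_le F s' hkn, h k le_rfl,
        rightProd_congr m (k + 1) (by omega) fun j hj => h j (Nat.le_of_succ_le hj)]

/-- The TCI form IS A TENSOR TRAIN with bond dimensions `χ_ℓ`: at every bond `ℓ = k+1`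
(`0 ≤ k ≤ n`), `F̃(s) = ∑_{x < χ_{k+1}} G(s)_x · H(s)_x` with `G = T₀ P₁⁻¹ ⋯ P_k⁻¹ T_k^{s k}`
depending only on the indices `s 0, …, s k` of the legs left of the bond (`leftProd_congr`) and
`H = P_{k+1}⁻¹ T_{k+1} ⋯ P_n⁻¹ T_n` depending only on the legs right of it (`rightProd_congr`);
so every unfolding `[F̃]_{(s_{≤k}), (s_{>k})}` factors through `Fin (χ (k+1))`, i.e. has rank
`≤ χ_{k+1}`.  [cite: NunezFernandezEtAl2025, §4.1; GolubVanLoan2013, §12.5.8 (12.5.25)] -/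
theorem tciEval_eq_sum_bond (s : ℕ → σ) {k : ℕ} (hk : k ≤ p.n) :
    p.tciEval F s = ∑ x : Fin (p.χ (k + 1)),
      (p.leftProd F s k * p.siteMat F k (s k)) p.rowZero x *
        p.rightProd F s (k + 1) x p.colLast := by
  rw [p.tciEval_eq_tciForm F s p.rowZero p.colLast,
    p.tciForm_eq_leftProd_mul_siteMat_mul_rightProd F s k hk, Matrix.mul_apply]

/-! ### Nesting conditions -/

/-- Row (left) nesting at bond `ℓ`, `I_ℓ < I_{ℓ+1}`: every row pivot of bond `ℓ+1` is a row pivot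
of bond `ℓ` extended by one leg index, `I_{ℓ+1} ⊆ I_ℓ × 𝕊_{ℓ+1}`.
[cite: NunezFernandezEtAl2025, §4.2; NunezFernandezEtAl2022, eq. (17a)] -/
def RowNested (ℓ : ℕ) : Prop :=
  ∀ x' : Fin (p.χ (ℓ + 1)), ∃ (x : Fin (p.χ ℓ)) (a : σ), p.row (ℓ + 1) x' = p.row ℓ x ++ [a]

/-- Column (right) nesting at bond `ℓ`, `J_{ℓ+1} > J_{ℓ+2}`: every column pivot of bond `ℓ` is a
column pivot of bond `ℓ+1` with one leg index prepended, `J_{ℓ+1} ⊆ 𝕊_{ℓ+1} × J_{ℓ+2}`.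
[cite: NunezFernandezEtAl2025, §4.2; NunezFernandezEtAl2022, eq. (17b)] -/
def ColNested (ℓ : ℕ) : Prop :=
  ∀ y : Fin (p.χ ℓ), ∃ (y' : Fin (p.χ (ℓ + 1))) (a : σ), p.col ℓ y = a :: p.col (ℓ + 1) y'

/-- FULL NESTING: `I_0 < I_1 < ⋯ < I_n` and `J_2 > J_3 > ⋯ > J_{n+2}` (in the paper's 1-based
numbering `I_0 < ⋯ < I_{L-1}`, `J_2 > ⋯ > J_{L+1}`, `L = n+1`).
[cite: NunezFernandezEtAl2025, §4.2; NunezFernandezEtAl2022, eq. (17)] -/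
def FullyNested (q : TCIPivots σ) : Prop :=
  (∀ ℓ, ℓ < q.n → q.RowNested ℓ) ∧ (∀ ℓ, 1 ≤ ℓ → ℓ ≤ q.n → q.ColNested ℓ)

/-! ### The Kronecker identities behind interpolation -/

/-- If the row pivot `x' ∈ I_{k+1}` is the extension `row k x ⊕ (a)` of `x ∈ I_k`, then row `x`
of `T_k^a` is row `x'` of `P_{k+1}`, hence row `x` of `A_k^a := T_k^a P_{k+1}⁻¹` is the unit
vector `e_{x'}`.  [cite: NunezFernandezEtAl2025, App. A.3; NunezFernandezEtAl2022, App. C.1 (C4)] -/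
theorem siteMat_mul_inv_pivMat_apply {k : ℕ} {a : σ} {x : Fin (p.χ k)} {x' : Fin (p.χ (k + 1))}
    (h : p.row (k + 1) x' = p.row k x ++ [a]) (hP : IsUnit (p.pivMat F (k + 1)).det)
    (z : Fin (p.χ (k + 1))) :
    (p.siteMat F k a * (p.pivMat F (k + 1))⁻¹) x z = if x' = z then 1 else 0 := by
  have hrow : ∀ y, p.siteMat F k a x y = p.pivMat F (k + 1) x' y := fun y => by
    simp [h, List.append_assoc]
  simp only [Matrix.mul_apply, hrow]
  rw [← Matrix.mul_apply, Matrix.mul_nonsing_inv _ hP, Matrix.one_apply]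

/-- If the column pivot `y ∈ J_{k+1}` is `(a) ⊕ col (k+1) y'` with `y' ∈ J_{k+2}`, then column
`y'` of `T_k^a` is column `y` of `P_k`, hence column `y'` of `B_k^a := P_k⁻¹ T_k^a` is the unit
vector `e_y`.  [cite: NunezFernandezEtAl2025, App. A.3; NunezFernandezEtAl2022, App. C.1 (C5)] -/
theorem inv_pivMat_mul_siteMat_apply {k : ℕ} {a : σ} {y : Fin (p.χ k)} {y' : Fin (p.χ (k + 1))}
    (h : p.col k y = a :: p.col (k + 1) y') (hP : IsUnit (p.pivMat F k).det) (z : Fin (p.χ k)) :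
    ((p.pivMat F k)⁻¹ * p.siteMat F k a) z y' = if z = y then 1 else 0 := by
  have hcol : ∀ x, p.siteMat F k a x y' = p.pivMat F k x y := fun x => by simp [h]
  simp only [Matrix.mul_apply, hcol]
  rw [← Matrix.mul_apply, Matrix.nonsing_inv_mul _ hP, Matrix.one_apply]

/-- LEFT TELESCOPE: if `I_0 < I_1 < ⋯ < I_k` and `x ∈ I_k` is the prefix `(s 0, …, s (k-1))` of
the configuration, then the row vector `T₀^{s 0} P₁⁻¹ ⋯ T_{k-1}^{s (k-1)} P_k⁻¹` is the unit
vector `e_x` (each factor `A_j = T_j P_{j+1}⁻¹` maps `e_{x_j} ↦ e_{x_{j+1}}` along the chain of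
prefixes, all of which are pivots by nesting).
[cite: NunezFernandezEtAl2025, App. A.3; NunezFernandezEtAl2022, App. C.1] -/
theorem leftProd_apply_of_rowNested (s : ℕ → σ)
    (hP : ∀ ℓ, 1 ≤ ℓ → ℓ ≤ p.n → IsUnit (p.pivMat F ℓ).det) :
    ∀ k, k ≤ p.n → (∀ ℓ < k, p.RowNested ℓ) → ∀ (x₀ : Fin (p.χ 0)) (x : Fin (p.χ k)),
      p.row k x = pfx s k → ∀ z, p.leftProd F s k x₀ z = if x = z then 1 else 0
  | 0, _, _, x₀, x, _, z => by
      obtain rfl := p.eq_of_bond_zero x₀ x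
      simp [leftProd, Matrix.one_apply]
  | k + 1, hk, hnest, x₀, x', hx', z => by
      obtain ⟨x, a, hxa⟩ := hnest k (Nat.lt_succ_self k) x'
      have h₂ : p.row k x ++ [a] = pfx s k ++ [s k] := by rw [← hxa, hx', pfx_succ]
      obtain ⟨hx, ha⟩ := List.append_inj' h₂ rfl
      obtain rfl : a = s k := by simpa using ha
      have ih := leftProd_apply_of_rowNested s hP k (Nat.le_of_succ_le hk)
        (fun ℓ hℓ => hnest ℓ (Nat.lt_succ_of_lt hℓ)) x₀ x hx
      rw [leftProd_succ, Matrix.mul_apply]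
      simp only [ih, ite_mul, one_mul, zero_mul, Finset.sum_ite_eq, Finset.mem_univ, if_true]
      exact p.siteMat_mul_inv_pivMat_apply F hxa (hP (k + 1) (Nat.succ_pos k) hk) z

/-- RIGHT TELESCOPE: if `J_{k+1} > J_{k+2} > ⋯ > J_{n+2}` and `y ∈ J_{k+1}` is the suffix
`(s k, …, s n)` of the configuration, then the column vector
`P_k⁻¹ T_k^{s k} ⋯ P_n⁻¹ T_n^{s n}` is the unit vector `e_y`.
[cite: NunezFernandezEtAl2025, App. A.3; NunezFernandezEtAl2022, App. C.1] -/
theorem rightProd_apply_of_colNested (s : ℕ → σ)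
    (hP : ∀ ℓ, 1 ≤ ℓ → ℓ ≤ p.n → IsUnit (p.pivMat F ℓ).det) :
    ∀ m k, k + m = p.n + 1 → 1 ≤ k → (∀ ℓ, k ≤ ℓ → ℓ ≤ p.n → p.ColNested ℓ) →
      ∀ (y₀ : Fin (p.χ (p.n + 1))) (y : Fin (p.χ k)), p.col k y = sfx s k m →
      ∀ z, p.rightProd F s k z y₀ = if z = y then 1 else 0
  | 0, k, hk, _, _, y₀, y, _, z => by
      obtain rfl : k = p.n + 1 := by omega
      obtain rfl := p.eq_of_bond_last y₀ y
      simp [rightProd_last, Matrix.one_apply]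
  | m + 1, k, hk, hk₁, hnest, y₀, y, hy, z => by
      have hkn : k ≤ p.n := by omega
      obtain ⟨y', a, hya⟩ := hnest k le_rfl hkn y
      have h₂ : a :: p.col (k + 1) y' = s k :: sfx s (k + 1) m := by rw [← hya, hy, sfx_succ]
      obtain ⟨ha, hy'⟩ := List.cons_eq_cons.mp h₂
      subst ha
      have ih := rightProd_apply_of_colNested s hP m (k + 1) (by omega) (by omega)
        (fun ℓ hℓ hℓn => hnest ℓ (Nat.le_of_succ_le hℓ) hℓn) y₀ y' hy'
      rw [p.rightProd_of_le F s hkn, Matrix.mul_apply]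
      simp only [ih, mul_ite, mul_one, mul_zero, Finset.sum_ite_eq', Finset.mem_univ, if_true]
      exact p.inv_pivMat_mul_siteMat_apply F hya (hP k hk₁ hkn) z

/-! ### Interpolation -/

/-- ONE-DIMENSIONAL SLICE INTERPOLATION (the main theorem).  If the pivots are nested with
respect to `T_k` — `I_0 < ⋯ < I_k` and `J_{k+2} > ⋯ > J_{n+2}` — and the pivot matrices are
nonsingular, then the TCI form reproduces the tensor exactly on the slice `I_k ⊕ 𝕊_k ⊕ J_{k+2}`:
for every configuration `s` whose prefix `(s 0,…,s (k-1))` is a row pivot `x ∈ I_k` and whose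
suffix `(s (k+1),…,s n)` is a column pivot `y ∈ J_{k+2}`, `F̃(s) = F(s)` (both telescopes collapse
and only `(T_k^{s k})_{x y} = F(s)` survives).
[cite: NunezFernandezEtAl2025, §4.2 and App. A.3; NunezFernandezEtAl2022, eq. (18), App. C.1] -/
theorem tciForm_apply_of_nested (s : ℕ → σ)
    (hP : ∀ ℓ, 1 ≤ ℓ → ℓ ≤ p.n → IsUnit (p.pivMat F ℓ).det) {k : ℕ} (hk : k ≤ p.n)
    (hI : ∀ ℓ < k, p.RowNested ℓ) (hJ : ∀ ℓ, k + 1 ≤ ℓ → ℓ ≤ p.n → p.ColNested ℓ)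
    {x : Fin (p.χ k)} (hx : p.row k x = pfx s k)
    {y : Fin (p.χ (k + 1))} (hy : p.col (k + 1) y = sfx s (k + 1) (p.n - k))
    (x₀ : Fin (p.χ 0)) (y₀ : Fin (p.χ (p.n + 1))) :
    p.tciForm F s x₀ y₀ = F (pfx s (p.n + 1)) := by
  rw [p.tciForm_eq_leftProd_mul_siteMat_mul_rightProd F s k hk, Matrix.mul_apply]
  simp only [Matrix.mul_apply]
  have hl := p.leftProd_apply_of_rowNested F s hP k hk hI x₀ x hx
  have hr := p.rightProd_apply_of_colNested F s hP (p.n - k) (k + 1) (by omega) (Nat.succ_pos k)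
    hJ y₀ y hy
  simp only [hl, hr, ite_mul, one_mul, zero_mul, mul_ite, mul_one, mul_zero, Finset.sum_ite_eq,
    Finset.sum_ite_eq', Finset.mem_univ, if_true]
  rw [siteMat_apply, hx, hy, pfx_eq_pfx_append_cons_sfx s hk]

/-- `tciEval` version of `tciForm_apply_of_nested`: `F̃(s) = F(s)` on the slice
`I_k ⊕ 𝕊_k ⊕ J_{k+2}` under nesting w.r.t. `T_k`.
[cite: NunezFernandezEtAl2025, §4.2 and App. A.3; NunezFernandezEtAl2022, eq. (18)] -/
theorem tciEval_of_nested (s : ℕ → σ)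
    (hP : ∀ ℓ, 1 ≤ ℓ → ℓ ≤ p.n → IsUnit (p.pivMat F ℓ).det) {k : ℕ} (hk : k ≤ p.n)
    (hI : ∀ ℓ < k, p.RowNested ℓ) (hJ : ∀ ℓ, k + 1 ≤ ℓ → ℓ ≤ p.n → p.ColNested ℓ)
    {x : Fin (p.χ k)} (hx : p.row k x = pfx s k)
    {y : Fin (p.χ (k + 1))} (hy : p.col (k + 1) y = sfx s (k + 1) (p.n - k)) :
    p.tciEval F s = F (pfx s (p.n + 1)) := by
  rw [p.tciEval_eq_tciForm F s p.rowZero p.colLast]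
  exact p.tciForm_apply_of_nested F s hP hk hI hJ hx hy _ _

/-- THE INTERPOLATION PROPERTY OF A FULLY NESTED TCI: if `I_0 < ⋯ < I_n`, `J_2 > ⋯ > J_{n+2}`
and all pivot matrices are nonsingular, the TCI form is exact on every one-dimensional slice
`T_k = F(I_k ⊕ 𝕊_k ⊕ J_{k+2})`, `k = 0, …, n`.
[cite: NunezFernandezEtAl2025, §4.2; NunezFernandezEtAl2022, eq. (18)] -/
theorem tciEval_of_fullyNested (hN : p.FullyNested) (s : ℕ → σ)
    (hP : ∀ ℓ, 1 ≤ ℓ → ℓ ≤ p.n → IsUnit (p.pivMat F ℓ).det) {k : ℕ} (hk : k ≤ p.n)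
    {x : Fin (p.χ k)} (hx : p.row k x = pfx s k)
    {y : Fin (p.χ (k + 1))} (hy : p.col (k + 1) y = sfx s (k + 1) (p.n - k)) :
    p.tciEval F s = F (pfx s (p.n + 1)) :=
  p.tciEval_of_nested F s hP hk (fun ℓ hℓ => hN.1 ℓ (by omega))
    (fun ℓ hℓ hℓn => hN.2 ℓ (by omega) hℓn) hx hy

/-- Slice interpolation in configuration form: under nesting w.r.t. `T_k`, for every row pivot
`i ∈ I_k`, leg value `a` and column pivot `j ∈ J_{k+2}`,
`F̃(i ⊕ a ⊕ j) = F(i ⊕ a ⊕ j) = (T_k)_{i a j}`.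
[cite: NunezFernandezEtAl2025, §4.2 and App. A.3; NunezFernandezEtAl2022, eq. (18)] -/
theorem tciEval_toSeq_slice (hP : ∀ ℓ, 1 ≤ ℓ → ℓ ≤ p.n → IsUnit (p.pivMat F ℓ).det)
    {k : ℕ} (hk : k ≤ p.n) (hI : ∀ ℓ < k, p.RowNested ℓ)
    (hJ : ∀ ℓ, k + 1 ≤ ℓ → ℓ ≤ p.n → p.ColNested ℓ)
    (x : Fin (p.χ k)) (a : σ) (y : Fin (p.χ (k + 1))) (d : σ) :
    p.tciEval F (toSeq (p.row k x ++ a :: p.col (k + 1) y) d) =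
      F (p.row k x ++ a :: p.col (k + 1) y) := by
  set l := p.row k x ++ a :: p.col (k + 1) y with hl
  have hxl : (p.row k x).length = k := p.length_row k x
  have hyl : (p.col (k + 1) y).length = p.n - k := by rw [p.length_col]; omega
  have hlen : l.length = p.n + 1 := by simp [hl, hxl, hyl]; omega
  have hx : p.row k x = pfx (toSeq l d) k := by
    have := pfx_toSeq_append (p.row k x) (a :: p.col (k + 1) y) d
    rw [hxl] at this
    rw [hl]
    exact this.symm
  have hy : p.col (k + 1) y = sfx (toSeq l d) (k + 1) (p.n - k) := by
    have := sfx_toSeq_append (p.row k x ++ [a]) (p.col (k + 1) y) d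
    rw [List.length_append, hxl, List.length_singleton, hyl, List.append_assoc,
      List.singleton_append] at this
    rw [hl]
    exact this.symm
  rw [p.tciEval_of_nested F (toSeq l d) hP hk hI hJ hx hy, ← hlen, pfx_toSeq_length]

/-- ZERO-DIMENSIONAL SLICES: under nesting w.r.t. `P_ℓ` — `I_0 < ⋯ < I_ℓ` and
`J_{ℓ+1} > ⋯ > J_{n+2}` — the TCI form reproduces the pivot matrix, `F̃(x ⊕ y) = (P_ℓ)_{x y}`
for `x ∈ I_ℓ`, `y ∈ J_{ℓ+1}` (configuration form: prefix `= row ℓ x`, suffix `= col ℓ y`).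
[cite: NunezFernandezEtAl2025, §4.2 and App. A.3; NunezFernandezEtAl2022, App. C.1] -/
theorem tciForm_apply_of_nested_pivot (s : ℕ → σ)
    (hP : ∀ ℓ', 1 ≤ ℓ' → ℓ' ≤ p.n → IsUnit (p.pivMat F ℓ').det) {ℓ : ℕ} (hℓ : ℓ ≤ p.n)
    (hI : ∀ ℓ' < ℓ, p.RowNested ℓ') (hJ : ∀ ℓ', ℓ ≤ ℓ' → ℓ' ≤ p.n → p.ColNested ℓ')
    {x : Fin (p.χ ℓ)} (hx : p.row ℓ x = pfx s ℓ)
    {y : Fin (p.χ ℓ)} (hy : p.col ℓ y = sfx s ℓ (p.n + 1 - ℓ))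
    (x₀ : Fin (p.χ 0)) (y₀ : Fin (p.χ (p.n + 1))) :
    p.tciForm F s x₀ y₀ = F (pfx s (p.n + 1)) := by
  obtain ⟨y', a, hya⟩ := hJ ℓ le_rfl hℓ y
  have h₂ : a :: p.col (ℓ + 1) y' = s ℓ :: sfx s (ℓ + 1) (p.n - ℓ) := by
    rw [← hya, hy, show p.n + 1 - ℓ = p.n - ℓ + 1 by omega, sfx_succ]
  obtain ⟨-, hy'⟩ := List.cons_eq_cons.mp h₂
  exact p.tciForm_apply_of_nested F s hP hℓ hI (fun ℓ' hℓ' hℓ'n => hJ ℓ' (by omega) hℓ'n) hx hy'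
    x₀ y₀

/-- Zero-dimensional slices in configuration form: under nesting w.r.t. `P_ℓ`,
`F̃(row ℓ x ⊕ col ℓ y) = (P_ℓ)_{x y}` — the TCI form interpolates the tensor on the pivots.
[cite: NunezFernandezEtAl2025, §4.2 and App. A.3; NunezFernandezEtAl2022, App. C.1] -/
theorem tciEval_toSeq_pivot (hP : ∀ ℓ', 1 ≤ ℓ' → ℓ' ≤ p.n → IsUnit (p.pivMat F ℓ').det)
    {ℓ : ℕ} (hℓ : ℓ ≤ p.n) (hI : ∀ ℓ' < ℓ, p.RowNested ℓ')
    (hJ : ∀ ℓ', ℓ ≤ ℓ' → ℓ' ≤ p.n → p.ColNested ℓ') (x y : Fin (p.χ ℓ)) (d : σ) :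
    p.tciEval F (toSeq (p.row ℓ x ++ p.col ℓ y) d) = p.pivMat F ℓ x y := by
  set l := p.row ℓ x ++ p.col ℓ y with hl
  have hxl : (p.row ℓ x).length = ℓ := p.length_row ℓ x
  have hyl : (p.col ℓ y).length = p.n + 1 - ℓ := p.length_col ℓ y
  have hlen : l.length = p.n + 1 := by simp [hl, hxl, hyl]; omega
  have hx : p.row ℓ x = pfx (toSeq l d) ℓ := by
    have := pfx_toSeq_append (p.row ℓ x) (p.col ℓ y) d
    rw [hxl] at this
    rw [hl]
    exact this.symm
  have hy : p.col ℓ y = sfx (toSeq l d) ℓ (p.n + 1 - ℓ) := by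
    have := sfx_toSeq_append (p.row ℓ x) (p.col ℓ y) d
    rw [hxl, hyl] at this
    rw [hl]
    exact this.symm
  rw [p.tciEval_eq_tciForm F _ p.rowZero p.colLast,
    p.tciForm_apply_of_nested_pivot F (toSeq l d) hP hℓ hI hJ hx hy, ← hlen, pfx_toSeq_length,
    pivMat_apply]

/-- Splitting off a TWO-SITE block: for `k + 1 ≤ n`,
`F̃(s) = (T₀ P₁⁻¹ ⋯ P_k⁻¹) · Π_k^{s k, s (k+1)} · (P_{k+2}⁻¹ T_{k+2} ⋯ T_n)` with the two-site
TCI tensor `Π_k^{a b} := T_k^a P_{k+1}⁻¹ T_{k+1}^b`.  [cite: NunezFernandezEtAl2025, §4.3.1 and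
App. A.3] -/
theorem tciForm_eq_leftProd_mul_twoSite_mul_rightProd (s : ℕ → σ) {k : ℕ} (hk : k + 1 ≤ p.n) :
    p.tciForm F s = p.leftProd F s k *
      (p.siteMat F k (s k) * (p.pivMat F (k + 1))⁻¹ * p.siteMat F (k + 1) (s (k + 1))) *
      p.rightProd F s (k + 2) := by
  rw [p.tciForm_eq_leftProd_mul_siteMat_mul_rightProd F s k (by omega), p.rightProd_of_le F s hk]
  simp only [Matrix.mul_assoc]

/-- TWO-DIMENSIONAL SLICES: under nesting w.r.t. `Π_k` — `I_0 < ⋯ < I_k` and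
`J_{k+3} > ⋯ > J_{n+2}` — the TCI form restricted to the slice `I_k ⊕ 𝕊_k ⊕ 𝕊_{k+1} ⊕ J_{k+3}`
IS the two-site TCI tensor: `F̃(x ⊕ a ⊕ b ⊕ y) = (T_k^a P_{k+1}⁻¹ T_{k+1}^b)_{x y}`.  Hence on that
slice the error of the global interpolation equals the error of the LOCAL matrix cross
interpolation `Π_k ≈ T_k P_{k+1}⁻¹ T_{k+1}`, which is what the 2-site TCI update minimises.
[cite: NunezFernandezEtAl2025, §4.3.1 and App. A.3; NunezFernandezEtAl2022, §III.B.2] -/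
theorem tciForm_apply_of_nested_twoSite (s : ℕ → σ)
    (hP : ∀ ℓ, 1 ≤ ℓ → ℓ ≤ p.n → IsUnit (p.pivMat F ℓ).det) {k : ℕ} (hk : k + 1 ≤ p.n)
    (hI : ∀ ℓ < k, p.RowNested ℓ) (hJ : ∀ ℓ, k + 2 ≤ ℓ → ℓ ≤ p.n → p.ColNested ℓ)
    {x : Fin (p.χ k)} (hx : p.row k x = pfx s k)
    {y : Fin (p.χ (k + 2))} (hy : p.col (k + 2) y = sfx s (k + 2) (p.n - (k + 1)))
    (x₀ : Fin (p.χ 0)) (y₀ : Fin (p.χ (p.n + 1))) :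
    p.tciForm F s x₀ y₀ =
      (p.siteMat F k (s k) * (p.pivMat F (k + 1))⁻¹ * p.siteMat F (k + 1) (s (k + 1))) x y := by
  set Q := p.siteMat F k (s k) * (p.pivMat F (k + 1))⁻¹ * p.siteMat F (k + 1) (s (k + 1))
    with hQ
  rw [p.tciForm_eq_leftProd_mul_twoSite_mul_rightProd F s hk, ← hQ, Matrix.mul_apply]
  simp only [Matrix.mul_apply]
  have hl := p.leftProd_apply_of_rowNested F s hP k (by omega) hI x₀ x hx
  have hr := p.rightProd_apply_of_colNested F s hP (p.n - (k + 1)) (k + 2) (by omega) (by omega)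
    hJ y₀ y hy
  simp only [hl, hr, ite_mul, one_mul, zero_mul, mul_ite, mul_one, mul_zero, Finset.sum_ite_eq,
    Finset.sum_ite_eq', Finset.mem_univ, if_true]

/-! ### The bond rank is exactly `χ_ℓ` -/

/-- RANK OF THE BONDS.  Under nesting w.r.t. `P_ℓ` (`1 ≤ ℓ ≤ n`), every finite sub-unfolding of
the TCI form across bond `ℓ` whose row configurations `u r` (lists of length `ℓ`) contain the row
pivots `I_ℓ` and whose column configurations `v c` contain the column pivots `J_{ℓ+1}` has rank
EXACTLY `χ_ℓ`: `≤ χ_ℓ` because the TCI form is a tensor train of bond dimension `χ_ℓ`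
(`tciEval_eq_sum_bond`), `≥ χ_ℓ` because its `I_ℓ × J_{ℓ+1}` submatrix is the nonsingular pivot
matrix `P_ℓ` (`tciEval_toSeq_pivot`, `card_le_rank_of_isUnit_det_submatrix`).
[cite: NunezFernandezEtAl2025, App. A.3 and §4.1] -/
theorem rank_unfolding_eq [Nontrivial K] {ρ γ : Type*} [Fintype ρ] [Fintype γ]
    (hP : ∀ ℓ', 1 ≤ ℓ' → ℓ' ≤ p.n → IsUnit (p.pivMat F ℓ').det) {ℓ : ℕ} (hℓ₁ : 1 ≤ ℓ)
    (hℓ : ℓ ≤ p.n) (hI : ∀ ℓ' < ℓ, p.RowNested ℓ') (hJ : ∀ ℓ', ℓ ≤ ℓ' → ℓ' ≤ p.n → p.ColNested ℓ')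
    (u : ρ → List σ) (hu : ∀ r, (u r).length = ℓ) (v : γ → List σ)
    {e : Fin (p.χ ℓ) → ρ} (he : ∀ x, u (e x) = p.row ℓ x)
    {f : Fin (p.χ ℓ) → γ} (hf : ∀ y, v (f y) = p.col ℓ y) (d : σ) :
    (Matrix.of fun r c => p.tciEval F (toSeq (u r ++ v c) d)).rank = p.χ ℓ := by
  classical
  set M : Matrix ρ γ K := Matrix.of fun r c => p.tciEval F (toSeq (u r ++ v c) d) with hM
  obtain ⟨k, rfl⟩ : ∃ k, ℓ = k + 1 := ⟨ℓ - 1, by omega⟩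
  apply le_antisymm
  · -- `M = A * B` factors through `Fin (χ (k+1))`
    set A : Matrix ρ (Fin (p.χ (k + 1))) K := Matrix.of fun r x =>
      (p.leftProd F (toSeq (u r) d) k * p.siteMat F k (toSeq (u r) d k)) p.rowZero x with hA
    set B : Matrix (Fin (p.χ (k + 1))) γ K := Matrix.of fun x c =>
      p.rightProd F (toSeq (List.replicate (k + 1) d ++ v c) d) (k + 1) x p.colLast with hB
    have hfac : M = A * B := by
      ext r c
      rw [Matrix.mul_apply, hM, Matrix.of_apply, p.tciEval_eq_sum_bond F _ (show k ≤ p.n by omega)]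
      refine Finset.sum_congr rfl fun x _ => ?_
      have h₁ : ∀ j < k + 1, toSeq (u r ++ v c) d j = toSeq (u r) d j := fun j hj =>
        toSeq_append_of_lt (u r) (v c) d (by rw [hu]; exact hj)
      rw [hA, hB, Matrix.of_apply, Matrix.of_apply,
        p.leftProd_congr F k fun j hj => h₁ j (Nat.lt_succ_of_lt hj), h₁ k (Nat.lt_succ_self k),
        p.rightProd_congr F (p.n - k) (k + 1) (by omega) fun j hj =>
          toSeq_append_of_le (u r) (List.replicate (k + 1) d) (v c) d (by simp [hu])
            (by rw [hu]; exact hj)]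
    calc M.rank = (A * B).rank := by rw [hfac]
      _ ≤ A.rank := Matrix.rank_mul_le_left A B
      _ ≤ Fintype.card (Fin (p.χ (k + 1))) := Matrix.rank_le_card_width A
      _ = p.χ (k + 1) := Fintype.card_fin _
  · -- the `I_ℓ × J_{ℓ+1}` submatrix of `M` is `P_ℓ`
    have hsub : M.submatrix e f = p.pivMat F (k + 1) := by
      ext x y
      rw [Matrix.submatrix_apply, hM, Matrix.of_apply, he, hf,
        p.tciEval_toSeq_pivot F hP hℓ hI hJ x y d]
    have := Literature.LinearAlgebra.Matrix.card_le_rank_of_isUnit_det_submatrix M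
      (r := e) (c := f) (by rw [hsub]; exact hP (k + 1) hℓ₁ hℓ)
    simpa using this

end TCIPivots

end Literature.LinearAlgebra.TensorNetworks
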